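import Summits.PneNP.Statement
import Literature.Algebra.EuclideanLattices.LatticeComplexity
import Literature.Computability.Cryptography.LatticeOWF
import Literature.Computability.Complexity.ClayProblem

/-!
# PneNP / Lattice — assembly

Route `PneNP/Lattice` ("approximating the shortest lattice vector within polynomial factors is
not in P"), assembly item `stmt-PneNP-0183`.

The item as typed,
`P_bool_eq → NP_bool_eq → P_subset_NP → X → PneNP` with
`X = ∀ γ, IsPolyBoundedReal γ → (∀ n, 1 ≤ γ n) → gapSVPPromise γ ∉ PromiseP`,
omits the route's crux #3 (`stmt-PneNP-0185`, `gapSVPPromise (fun n => n) ∈ PromiseNP`) from its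
hypotheses, so a proof of it would have to build an `NP` verifier for `GapSVP` (a
`Turing.TM2ComputableInPolyTime` machine) inside the assembly.  This file lands the honest
bookkeeping form: with crux #3 as an explicit hypothesis the assembly is elementary, and the
hypothesis `P_subset_NP` is not needed.  Two small lemmas absorb the `n = 0` wrinkle noted by
the grounder (`γ = id` violates `1 ≤ γ 0`): the thesis is instantiated at `γ' n = max n 1`,
which is polynomially bounded and `≥ 1`, and `GapSVP_{γ'}` inherits any separating language of
`GapSVP_n` because a larger gap only shrinks the no-set (`GapSVP.no_subset_no_of_le`).

(`LatticeOWF` is imported so that the sibling signature of `stmt-PneNP-0186` elaborates in this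
file's context.)
-/

namespace Literature.PQC

open Literature.Computability.Complexity Literature.Algebra.EuclideanLattices

/-- A larger gap is an easier promise problem, at the level of promise classes: if `γ ≤ γ'`
pointwise and some `L ∈ C` separates `GapSVP_γ`, the same `L` separates `GapSVP_{γ'}` (the
yes-sets coincide and `no γ' ⊆ no γ`). [Micciancio–Goldwasser 2002, Ch. 1, §1.2] [folklore] -/
theorem gapSVPPromise_mem_promiseLift_of_le {C : Set (Language Bool)} {γ γ' : ℕ → ℝ}
    (hle : γ ≤ γ') (h : gapSVPPromise γ ∈ promiseLift C) : gapSVPPromise γ' ∈ promiseLift C := by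
  obtain ⟨L, hL, hy, hn⟩ := h
  refine ⟨L, hL, hy, ?_⟩
  intro w hw
  apply hn
  obtain ⟨p, hp, rfl⟩ := hw
  exact ⟨p, GapSVP.no_subset_no_of_le hle hp, rfl⟩

/-- The factor `γ' n = max n 1` is polynomially bounded (by `X + 1`). [folklore] -/
theorem isPolyBoundedReal_max_natCast_one : IsPolyBoundedReal fun n => max (n : ℝ) 1 := by
  refine ⟨Polynomial.X + 1, fun n => ?_⟩
  simp only [Polynomial.eval_add, Polynomial.eval_X, Polynomial.eval_one, Nat.cast_add,
    Nat.cast_one]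
  exact max_le (by linarith) (by simp)

/-- Assembly of route `PneNP/Lattice` (honest form of `stmt-PneNP-0183`, with crux #3
`stmt-PneNP-0185` as a hypothesis and without the unused `P_subset_NP`): if `GapSVP_n` has an
`NP` separating language `L` and no `GapSVP_γ` with `γ ≥ 1` polynomially bounded lies in
`PromiseP`, then `L ∈ NP \ P`, i.e. `P ≠ NP` in Cook's form (via the model bridges
`P_bool_eq`, `NP_bool_eq`).  The thesis is used at `γ' = max n 1`.
[Micciancio–Goldwasser 2002, Ch. 1, §1.2] [folklore] -/
theorem pneNP_of_gapSVP_notMem_promiseP_of_mem_promiseNP :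
    Literature.Computability.Complexity.P_bool_eq → Literature.Computability.Complexity.NP_bool_eq →
    (∀ γ : ℕ → ℝ, IsPolyBoundedReal γ → (∀ n, 1 ≤ γ n) → gapSVPPromise γ ∉ PromiseP) →
    gapSVPPromise (fun n => (n : ℝ)) ∈ PromiseNP → PneNP := by
  intro hP hNP hX h185
  have h185' : gapSVPPromise (fun n => max (n : ℝ) 1) ∈ PromiseNP :=
    gapSVPPromise_mem_promiseLift_of_le (fun n => le_max_left _ _) h185
  obtain ⟨L, hL, hy, hn⟩ := h185'
  refine ⟨L, ?_, ?_⟩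
  · rw [hNP]; exact hL
  · intro hLP
    rw [hP] at hLP
    exact hX _ isPolyBoundedReal_max_natCast_one (fun n => le_max_right _ _) ⟨L, hLP, hy, hn⟩

/-- The item `stmt-PneNP-0183` exactly as typed, reduced to crux #3: given
`gapSVPPromise (fun n => n) ∈ PromiseNP` (`stmt-PneNP-0185`) the typed assembly holds
(and ignores `P_subset_NP`). [folklore] -/
theorem lattice_assembly_of_mem_promiseNP
    (h185 : gapSVPPromise (fun n => (n : ℝ)) ∈ PromiseNP) :
    Literature.Computability.Complexity.P_bool_eq → Literature.Computability.Complexity.NP_bool_eq → Literature.Computability.Complexity.P_subset_NP →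
    (∀ γ : ℕ → ℝ, Literature.Algebra.EuclideanLattices.IsPolyBoundedReal γ → (∀ n, 1 ≤ γ n) →
      Literature.Algebra.EuclideanLattices.gapSVPPromise γ ∉ Literature.Computability.Complexity.PromiseP) → PneNP :=
  fun hP hNP _ hX => pneNP_of_gapSVP_notMem_promiseP_of_mem_promiseNP hP hNP hX h185

/-- Junk audit for `γ = id` at dimension `n = 0` (recorded for the refuter notes on
`stmt-PneNP-0184/0185`): the empty lattice has `λ₁ = 0` (junk value of `minNorm ⊥`), so no
dimension-`0` instance is a no-instance of `GapSVP_n` (`0 · d < 0` fails) and the promise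
problem stays disjoint there even though `γ 0 = 0 < 1`. [folklore] -/
theorem not_mem_gapSVP_no_natCast_of_n_eq_zero (I : LatticeInstance) (hI : I.n = 0) (d : ℚ) :
    (I, d) ∉ GapSVP.no (fun n => (n : ℝ)) := by
  rw [mem_gapSVP_no_iff]
  rintro ⟨-, -, h⟩
  obtain ⟨n, B⟩ := I
  cases hI
  simp only [CharP.cast_eq_zero, zero_mul] at h
  have : minNorm (LatticeInstance.lattice ⟨0, B⟩) = 0 := by
    unfold minNorm
    have hs : {x : EuclideanSpace ℝ (Fin 0) | x ∈ LatticeInstance.lattice ⟨0, B⟩ ∧ x ≠ 0} = ∅ := by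
      ext x; simp [Subsingleton.elim x 0]
    rw [hs, Set.image_empty, Real.sInf_empty]
  linarith

end Literature.PQC
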